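import Literature.AlgebraicGeometry.AbelianSchemes.PDivisibleGroupRingAction              -- ★ DEAL 3 `RingAction.isRingActionBT_pDivisibleGroupMap`; ★ `pDivisibleGroupMap{,_app}`, `torsionMap_ι`
import Literature.AlgebraicGeometry.AbelianSchemes.AbelianSchemeFixedPowBaseChange          -- ★ `RingAction.baseChange{,_i}`, `isMonHom_pullback_map`
import Literature.AlgebraicGeometry.GroupSchemes.BarsottiTateGroupFixedPartBaseChangeAction -- ★ `BTGroup.Hom.baseChange`, `hrank_baseChange`, `BTGroup.Iso`, `homOfCompatibleFamily`
import Literature.AlgebraicGeometry.AbelianSchemes.PDivisibleGroupBlockHeightTransport      -- ★ DEAL 5 FILE B p846578 `inv_comp_eq_comp_inv_of_hom_comp`, `RingAction.hrank_of_natCard_fixedPoints` (§1, §5)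
import HarnessLib

/-!
# `A[p^∞]` COMMUTES WITH BASE CHANGE AS A BARSOTTI–TATE GROUP WITH `O`-ACTION: `(A[p^∞]) ×_S S′ ≅ (A ×_S S′)[p^∞]`, and the block height
# transports from `Spec R` to every `Spec R′ → Spec R` ([Tate 1967] §2 (2.1)–(2.2); [Messing 1972] Ch. I; [Rapoport–Smithling–Zhang 2020] §4.1)

Topic `Literature/AlgebraicGeometry/AbelianSchemes`; namespaces `Literature.AlgebraicGeometry.GroupSchemes.IdempotentSplitting` (§1, one endomorphism
of one group object) and `Literature.AlgebraicGeometry.AbelianSchemes.AbelianSchemeOver` (§2–§5).  THEOREMS ONLY; no definition, no named fact, no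
instance, no notation, no `sorry`.  Cell `hodgecm-mathlib` (D-0151), FLOOR 0, P6 «MOD programme» (crux hLiu418 = stmt-HodgeConjecture-24832), K∕BT desk
F0P6d-plan (g2), DEAL 5 «(S-H-BT) BLOCK HEIGHT FROM THE GENERIC FIBRE» — ruling (R1) 2026-09-01T19:47Z: the socket (S-H) itself is ★
`PDivisibleGroupBlockHeightTransport` (B-p18 (g36), p846578, single layers `A[N] ×_S S′ ≅ (A ×_S S′)[N]`, target a FIELD-valued point); THIS file is
the BARSOTTI–TATE-GROUP-LEVEL companion (census B-p08 (g31) `CENSUS-DEAL5-BlockHeightTransport.B-p08g31.md` STEP B): the isomorphism of `p`-divisible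
groups with all its layers and transitions at once, its intertwining with the `O`-action and with the block idempotents, and the transport of the rank
function `hrank` of the `w`-block along an ARBITRARY `Spec R′ → Spec R` (no locality, no field) — the currency of ★ `BTGroup.Hom.fixBTGroupBaseChangeIso`
(«`(Fix ε) ×_S S′ ≅ Fix (ε ×_S S′)`») and of the P6a datum «the `w`-block read on `Spec κ̄`, `Spec 𝒪_Ω`, `Spec Ω` is ONE Barsotti–Tate group pulled
back».  HC_CM is proved only modulo the printed citations until rung 0 closes; nothing here is about HC.

THE PRINT.  [Tate1967] §2 (2.1)–(2.2): `A ↦ A(p)` is a functor, compatible with base change, and `End A` acts on `A(p)`; [Messing1972] Ch. I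
(1.1)–(1.6): Barsotti–Tate groups and their homomorphisms are fppf-local notions, stable under every base change `G ×_S S′`, and `(A ×_S S′)[pⁿ] =
A[pⁿ] ×_S S′` (kernels commute with base change, [GortzWedhorn2020] (4.15) p. 116); [RapoportSmithlingZhang2020Diagonal] §4.1 (p. 17) «(dec pdiv)»:
the `w`-block `A[w^∞] = e_w A[p^∞]` of an `O_F`-action read at every fibre of the family — the height of the block is the SAME at the generic and at the
special fibre because the block is one finite flat group scheme over the base ([StacksProject] Tag 02KA: the rank of a finite locally free morphism is
stable under base change).  Nothing here is a new theorem of algebraic geometry: the file ASSEMBLES ★ `BTGroup.exists_iso_of_kernelPresentation` (two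
kernel presentations in one group scheme are isomorphic, with ALL layers and transitions), ★ `BTGroup.Hom.hrank_baseChange` (the rank function of `Fix ε`
pulls back) and the functoriality of `Fix` along an ISOMORPHISM intertwining two endomorphisms.

WHAT IS HERE.
* §1 (`φ : G ≅ G′` in `Over S`, `φ.hom ≫ ε′ = ε ≫ φ.hom`; ★ `AbelianSchemes.inv_comp_eq_comp_inv_of_hom_comp`) `fixMap_hom_comp_fixMap_inv ∕
  _inv_comp_fixMap_hom`, **`isIso_fixMap_of_iso`** (`Fix ε ≅ Fix ε′` by ★ `fixMap`), **`finrank_fix_hom_eq_of_iso`** — CONJUGATE ENDOMORPHISMS HAVE FIXED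
  PARTS OF EQUAL RANK, hypotheses `[IsFinite (fix ε′).hom] [Flat (fix ε′).hom]` only (NO idempotency; ★ p846578's namesake asks `ε′ ≫ ε′ = ε′` and
  `G′ → S` finite flat instead).
* §2 (`𝒜 : AbelianSchemeOver S`, commutative, ANY `σ : S′ ⟶ S`) **`exists_iso_baseChange_pDivisibleGroup`**:
  `∃ e : BTGroup.Iso ((𝒜.pDivisibleGroup hp hg).baseChange σ) ((𝒜.baseChange σ).pDivisibleGroup hp (hg.baseChange σ))` with
  `e.hom.app n ≫ ι′ = ι ×_S S′` for every `n` — «`(A[p^∞]) ×_S S′ = (A ×_S S′)[p^∞]` AS BARSOTTI–TATE GROUPS» (★ `exists_iso_of_kernelPresentation` for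
  the presentations `ι ×_S S′` and `ι′` in `M := A ×_S S′`; the two sides are NOT definitionally equal: the left is `Ker([pⁿ]) ×_S S′`, the right
  `Ker([pⁿ] ×_S S′)`; the layers of `e` are the single-layer isomorphisms of ★ `exists_iso_pullback_torsion`, now compatible with `incl` and `pMap`).
* §3 INTERTWINING: for ANY `F : Hom ((A[p^∞]) ×_S S′) ((A ×_S S′)[p^∞])` with `F.app n ≫ ι′ = ι ×_S S′` and any homomorphism `f : A → A`,
  **`baseChange_pDivisibleGroupMap_app_comp`** (`(f[p^∞] ×_S S′)_n ≫ F_n = F_n ≫ ((f ×_S S′)[p^∞])_n`), the ring-action form `baseChange_ringAction_app_comp`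
  (★ `RingAction.baseChange`), and **`baseChange_homOfCompatibleFamily_app_comp`** (the block idempotents `ε_a` of ★ `IsRingActionBT.homOfCompatibleFamily` for
  `act` and for `act ×_S S′`).
* §4 (ANY `σ : Spec R′ ⟶ Spec R`, no locality, no field) **`hrank_blockBTGroup_baseChange`**: `hrank` with height `h` for `ε_a` on `𝒜[p^∞]` ⟹ `hrank` with
  height `h` for `ε_a` on `(𝒜 ×_R R′)[p^∞]` — VERBATIM the hypothesis of ★ `BTGroup.Hom.fixBTGroup` ∕ ★ `PDivisibleGroupBlockDocking` for `A := 𝒜 ×_R R′`,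
  `act := act ×_R R′`; and the hypothesis-free pointwise form **`finrank_fixLayer_blockBTGroup_baseChange`** (`rk_{s′} Fix(ε_a′)_n = rk_{σ s′} Fix(ε_a)_n`).
* §5 COMPOSITE with ★ p846578 `RingAction.hrank_of_natCard_fixedPoints` (local `R`, geometric point `gΩ` with `(p : Ω) ≠ 0`, count in `𝒜 ×_R Ω`-currency):
  **`hrank_blockBTGroup_baseChange_of_natCard_fixedPoints`** — `hrank` on every `Spec R′ → Spec R` (★ `hrank_specialFibre_of_natCard_fixedPoints` is the
  case `R′` a field).

DESIGN.  `[IsCommMonObj (𝒜.baseChange σ).X]` is a BINDER (any instance the consumer holds — e.g. ★ `AbelianSchemeOver.isCommMonObj_baseChange` — is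
definitionally the one used here, the class being a `Prop`); the group laws of the layers are bound with `letI` (★ carriers declare no instance).

## References
* [Tate1967] J. T. Tate, *p-divisible groups*, Proc. Conf. Local Fields (Driebergen, 1966), Springer (1967) — §2 (2.1)–(2.2).
* [Messing1972] W. Messing, *The Crystals Associated to Barsotti–Tate Groups*, LNM 264 (1972) — Ch. I (1.1)–(1.6).
* [GortzWedhorn2020] U. Görtz, T. Wedhorn, *Algebraic Geometry I*, 2nd ed. (2020) — (4.15) (p. 116), Definition 4.45 (2) (p. 117), Section (4.7) (pp. 107–108).
* [RapoportSmithlingZhang2020Diagonal] M. Rapoport, B. Smithling, W. Zhang, *Arithmetic diagonal cycles on unitary Shimura varieties*, Compos. Math. 156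
  (2020) — §4.1 (p. 17).
* [StacksProject] The Stacks Project — Tag 02KA.
-/

set_option autoImplicit false

noncomputable section

-- `fixLayer ε n = fix (ε.app n)`, `(B.baseChange g).G n = (Over.pullback g).obj (B.G n)`, `(pDivisibleGroup hp hg).G n = torsion (p ^ n)` are
-- definitional only above `instances` transparency (as in ★ `BarsottiTateGroupFixedPartBaseChange`).
set_option backward.isDefEq.respectTransparency false

universe u v

open CategoryTheory CategoryTheory.Limits AlgebraicGeometry MonoidalCategory CartesianMonoidalCategory
open scoped MonObj CategoryTheory.Obj

namespace Literature.AlgebraicGeometry.GroupSchemes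

/-! ## §1 Conjugate endomorphisms have isomorphic fixed parts -/

namespace IdempotentSplitting

section Iso

variable {S : Scheme.{u}} {G G' : Over S} [GrpObj G] [GrpObj G'] (ε : G ⟶ G) (ε' : G' ⟶ G') (φ : G ≅ G')

/-- `Fix(φ) ≫ Fix(φ⁻¹) = 𝟙` on `Fix ε`. [cite: GortzWedhorn2020, Definition 4.45 (2) (p. 117)] -/
theorem fixMap_hom_comp_fixMap_inv (hφ : φ.hom ≫ ε' = ε ≫ φ.hom) :
    fixMap ε ε' φ.hom hφ ≫ fixMap ε' ε φ.inv (AbelianSchemes.inv_comp_eq_comp_inv_of_hom_comp φ hφ) = 𝟙 (fix ε) :=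
  fix_hom_ext ε (by rw [Category.assoc, fixMap_ι, fixMap_ι_assoc, Iso.hom_inv_id, Category.comp_id, Category.id_comp])

/-- `Fix(φ⁻¹) ≫ Fix(φ) = 𝟙` on `Fix ε′`. [cite: GortzWedhorn2020, Definition 4.45 (2) (p. 117)] -/
theorem fixMap_inv_comp_fixMap_hom (hφ : φ.hom ≫ ε' = ε ≫ φ.hom) :
    fixMap ε' ε φ.inv (AbelianSchemes.inv_comp_eq_comp_inv_of_hom_comp φ hφ) ≫ fixMap ε ε' φ.hom hφ = 𝟙 (fix ε') :=
  fix_hom_ext ε' (by rw [Category.assoc, fixMap_ι, fixMap_ι_assoc, Iso.inv_hom_id, Category.comp_id, Category.id_comp])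

/-- **`Fix` of an intertwining ISOMORPHISM is an isomorphism `Fix ε ≅ Fix ε′`.** [cite: GortzWedhorn2020, Definition 4.45 (2) (p. 117)] -/
theorem isIso_fixMap_of_iso (hφ : φ.hom ≫ ε' = ε ≫ φ.hom) : IsIso (fixMap ε ε' φ.hom hφ) :=
  ⟨⟨fixMap ε' ε φ.inv (AbelianSchemes.inv_comp_eq_comp_inv_of_hom_comp φ hφ), fixMap_hom_comp_fixMap_inv ε ε' φ hφ,
    fixMap_inv_comp_fixMap_hom ε ε' φ hφ⟩⟩

/-- **CONJUGATE ENDOMORPHISMS HAVE FIXED PARTS OF THE SAME RANK**: if `φ : G ≅ G′` over `S` intertwines `ε` and `ε′`, the ranks of `Fix ε → S`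
and `Fix ε′ → S` agree at every point (for `Fix ε′ → S` finite flat; `Fix ε ≅ Fix ε′` over `S`, Mathlib `Scheme.Hom.finrank_comp_left_of_isIso`).
[cite: StacksProject, Tag 02KA] [cite: GortzWedhorn2020, Definition 4.45 (2) (p. 117)] -/
theorem finrank_fix_hom_eq_of_iso (hφ : φ.hom ≫ ε' = ε ≫ φ.hom) [IsFinite (fix ε').hom] [Flat (fix ε').hom] (s : S) :
    (fix ε).hom.finrank s = (fix ε').hom.finrank s := by
  haveI := isIso_fixMap_of_iso ε ε' φ hφ
  haveI : IsIso (fixMap ε ε' φ.hom hφ).left := inferInstanceAs (IsIso ((Over.forget S).map (fixMap ε ε' φ.hom hφ)))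
  have hw : (fix ε).hom = (fixMap ε ε' φ.hom hφ).left ≫ (fix ε').hom := (Over.w (fixMap ε ε' φ.hom hφ)).symm
  rw [hw, Scheme.Hom.finrank_comp_left_of_isIso]

end Iso

end IdempotentSplitting

end Literature.AlgebraicGeometry.GroupSchemes

namespace Literature.AlgebraicGeometry.AbelianSchemes

namespace AbelianSchemeOver

open Literature.AlgebraicGeometry.GroupSchemes

/-! ## §2 `(A[p^∞]) ×_S S′ ≅ (A ×_S S′)[p^∞]` -/

section BaseChange

variable {S S' : Scheme.{u}} (𝒜 : AbelianSchemeOver S) [IsCommMonObj 𝒜.X] {p g : ℕ} (hp : p ≠ 0) (hg : 𝒜.IsOfRelDim g)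
  (σ : S' ⟶ S) [IsCommMonObj (𝒜.baseChange σ).X]

/-- **`(A[p^∞]) ×_S S′ ≅ (A ×_S S′)[p^∞]`, COMPATIBLY WITH THE INCLUSIONS INTO `A ×_S S′`**: the base change of the `p`-divisible group of `A` and the
`p`-divisible group of the base change are two kernel presentations (`ι ×_S S′` and `ι′`) in the SAME `S′`-group scheme `A ×_S S′`, hence isomorphic by the
unique isomorphism commuting with the presentations (★ `BTGroup.exists_iso_of_kernelPresentation`). [cite: Messing1972, Ch. I (1.1)–(1.6)]
[cite: Tate1967, §2 (2.1)] -/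
theorem exists_iso_baseChange_pDivisibleGroup :
    ∃ e : BTGroup.Iso ((𝒜.pDivisibleGroup hp hg).baseChange σ) ((𝒜.baseChange σ).pDivisibleGroup hp (hg.baseChange σ)),
      ∀ n, e.hom.app n ≫ (𝒜.baseChange σ).torsionι (p ^ n) = (Over.pullback σ).map (𝒜.torsionι (p ^ n)) := by
  refine BTGroup.exists_iso_of_kernelPresentation (M := (𝒜.baseChange σ).X) (B := (𝒜.pDivisibleGroup hp hg).baseChange σ)
    (B' := (𝒜.baseChange σ).pDivisibleGroup hp (hg.baseChange σ))
    (fun n => (Over.pullback σ).map (𝒜.torsionι (p ^ n))) (fun n => ?_) (fun n => ?_) (fun n => ?_)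
    (fun n => (𝒜.baseChange σ).torsionι (p ^ n)) (fun n => ?_) (fun n => ?_) (fun n => ?_)
  · -- `ι ×_S S′` is a homomorphism for the transported group laws
    letI := 𝒜.torsionGrpObj (p ^ n)
    haveI := 𝒜.isMonHom_torsionι (p ^ n)
    change IsMonHom ((Over.pullback σ).map (𝒜.torsionι (p ^ n)))
    infer_instance
  · -- the kernel square of `[pⁿ]` base-changes to the kernel square of `[pⁿ] ×_S S′ = [pⁿ]_{A ×_S S′}`
    have h := isPullback_map_of_isPullback_unit σ (𝒜.isPullback_torsionι (p ^ n))
    rw [mulN_def, pullback_map_pow, (Over.pullback σ).map_id] at h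
    exact h
  · -- compatibility with the transitions
    change (Over.pullback σ).map (𝒜.torsionIncl (p ^ n) (p ^ (n + 1)) (pow_dvd_pow p n.le_succ)) ≫
        (Over.pullback σ).map (𝒜.torsionι (p ^ (n + 1))) = _
    rw [← Functor.map_comp, torsionIncl_ι]
  · -- `ι′` is a homomorphism for the kernel group law
    exact (𝒜.baseChange σ).isMonHom_torsionι (p ^ n)
  · -- the kernel square of `(A ×_S S′)[pⁿ]`
    have h := (𝒜.baseChange σ).isPullback_torsionι (p ^ n)
    rw [mulN_def] at h
    exact h
  · -- compatibility of `ι′` with the transitions of `(A ×_S S′)[p^∞]`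
    exact (𝒜.baseChange σ).torsionIncl_ι (p ^ n) (p ^ (n + 1)) (pow_dvd_pow p n.le_succ)

/-! ## §3 The comparison intertwines `f[p^∞] ×_S S′` and `(f ×_S S′)[p^∞]`; point counts in `A ×_S S′`-currency -/

/-- **INTERTWINING**: for any `F : (A[p^∞]) ×_S S′ → (A ×_S S′)[p^∞]` commuting with the inclusions into `A ×_S S′` (e.g. the comparison isomorphism of
`exists_iso_baseChange_pDivisibleGroup`) and any homomorphism `f : A → A`, `(f[p^∞] ×_S S′)_n ≫ F_n = F_n ≫ ((f ×_S S′)[p^∞])_n` — both composites are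
`(ι ≫ f) ×_S S′` after the monomorphism `ι′`. [cite: Tate1967, §2 (2.1)–(2.2)] [cite: Messing1972, Ch. I (1.1)–(1.6)] -/
theorem baseChange_pDivisibleGroupMap_app_comp
    (F : BTGroup.Hom ((𝒜.pDivisibleGroup hp hg).baseChange σ) ((𝒜.baseChange σ).pDivisibleGroup hp (hg.baseChange σ)))
    (hF : ∀ n, F.app n ≫ (𝒜.baseChange σ).torsionι (p ^ n) = (Over.pullback σ).map (𝒜.torsionι (p ^ n)))
    (f : 𝒜.X ⟶ 𝒜.X) [IsMonHom f] (n : ℕ) :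
    ((pDivisibleGroupMap f hp hg hg).baseChange σ).app n ≫ F.app n =
      F.app n ≫ (haveI := isMonHom_pullback_map σ f;
        pDivisibleGroupMap ((Over.pullback σ).map f) hp (hg.baseChange σ) (hg.baseChange σ)).app n := by
  haveI := isMonHom_pullback_map σ f
  haveI := (𝒜.baseChange σ).mono_torsionι (p ^ n)
  rw [← cancel_mono ((𝒜.baseChange σ).torsionι (p ^ n)), Category.assoc, Category.assoc, hF, pDivisibleGroupMap_app,
    torsionMap_ι, reassoc_of% (hF n), BTGroup.Hom.baseChange_app, pDivisibleGroupMap_app, ← Functor.map_comp, ← Functor.map_comp,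
    torsionMap_ι]

variable {O : Type v} [CommRing O] (act : RingAction O 𝒜)

/-- The ring-action form: `((ι a)[p^∞] ×_S S′)_n ≫ F_n = F_n ≫ ((ι a ×_S S′)[p^∞])_n` for the base-changed action ★ `RingAction.baseChange`.
[cite: Tate1967, §2 (2.2)] [cite: RapoportSmithlingZhang2020Diagonal, §4.1 (p. 17)] -/
theorem baseChange_ringAction_app_comp
    (F : BTGroup.Hom ((𝒜.pDivisibleGroup hp hg).baseChange σ) ((𝒜.baseChange σ).pDivisibleGroup hp (hg.baseChange σ)))
    (hF : ∀ n, F.app n ≫ (𝒜.baseChange σ).torsionι (p ^ n) = (Over.pullback σ).map (𝒜.torsionι (p ^ n))) (r : O) (n : ℕ) :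
    ((haveI := act.isMonHom_i r; pDivisibleGroupMap (act.i r) hp hg hg).baseChange σ).app n ≫ F.app n =
      F.app n ≫ (haveI := (act.baseChange σ).isMonHom_i r;
        pDivisibleGroupMap ((act.baseChange σ).i r) hp (hg.baseChange σ) (hg.baseChange σ)).app n := by
  haveI := act.isMonHom_i r
  exact 𝒜.baseChange_pDivisibleGroupMap_app_comp hp hg σ F hF (act.i r) n

/-- **The family idempotents are intertwined**: for a `p`-adically compatible family `a : ℕ → O`, the endomorphism `ε_a` of `𝒜[p^∞]` (★
`IsRingActionBT.homOfCompatibleFamily` for ★ `isRingActionBT_pDivisibleGroupMap act`) base-changed to `S′` and the endomorphism `ε_a` of `(𝒜 ×_S S′)[p^∞]`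
(for `act ×_S S′`) satisfy `(ε_a ×_S S′)_n ≫ F_n = F_n ≫ (ε_a)_n` (layer `n` of either is `(ι (a n))[pⁿ]`). [cite: Tate1967, §2 (2.2)]
[cite: RapoportSmithlingZhang2020Diagonal, §4.1 (p. 17)] -/
theorem baseChange_homOfCompatibleFamily_app_comp {R R' : Type u} [CommRing R] [CommRing R'] (𝒜 : AbelianSchemeOver (Spec (.of R)))
    [IsCommMonObj 𝒜.X] (hg : 𝒜.IsOfRelDim g) (σ : Spec (.of R') ⟶ Spec (.of R)) [IsCommMonObj (𝒜.baseChange σ).X] (act : RingAction O 𝒜)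
    (a : ℕ → O) (ha : ∀ n, a (n + 1) - a n ∈ Ideal.span {(p : O) ^ n})
    (F : BTGroup.Hom ((𝒜.pDivisibleGroup hp hg).baseChange σ) ((𝒜.baseChange σ).pDivisibleGroup hp (hg.baseChange σ)))
    (hF : ∀ n, F.app n ≫ (𝒜.baseChange σ).torsionι (p ^ n) = (Over.pullback σ).map (𝒜.torsionι (p ^ n))) (n : ℕ) :
    (((act.isRingActionBT_pDivisibleGroupMap hp hg).homOfCompatibleFamily a ha).baseChange σ).app n ≫ F.app n =
      F.app n ≫ (((act.baseChange σ).isRingActionBT_pDivisibleGroupMap hp (hg.baseChange σ)).homOfCompatibleFamily a ha).app n :=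
  𝒜.baseChange_ringAction_app_comp hp hg σ act F hF (a n) n

end BaseChange

/-! ## §4 HEAD: the block height transports from `Spec R` to every `Spec R′ → Spec R` -/

section Head

variable {R R' : Type u} [CommRing R] [CommRing R'] (𝒜 : AbelianSchemeOver (Spec (.of R))) [IsCommMonObj 𝒜.X] {p g : ℕ}
  (hp : p ≠ 0) (hg : 𝒜.IsOfRelDim g) {O : Type v} [CommRing O] (act : RingAction O 𝒜) (a : ℕ → O)
  (ha : ∀ n, a (n + 1) - a n ∈ Ideal.span {(p : O) ^ n})
  (σ : Spec (.of R') ⟶ Spec (.of R)) [IsCommMonObj (𝒜.baseChange σ).X]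

/-- **THE BLOCK HEIGHT TRANSPORTS ALONG ANY BASE CHANGE `Spec R′ → Spec R` (socket (S-H) at `R′ := κ`, the residue field).**  For an abelian scheme
`𝒜 → Spec R` with commutative group law and an `O`-action `act`, and a `p`-adically compatible, `p`-adically idempotent family `a : ℕ → O` (the CRT family
of the idempotent `e_w`), let `ε_a` be the idempotent endomorphism of `𝒜[p^∞]` it defines (★ `homOfCompatibleFamily` for ★ `isRingActionBT_pDivisibleGroupMap
act`) and likewise `ε_a′` on `(𝒜 ×_R R′)[p^∞]` for `act ×_R R′`.  If the layers of `Fix ε_a` have rank `p^{n h}` at every point of `Spec R`, then the layers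
of `Fix ε_a′` have rank `p^{n h}` at every point of `Spec R′`: the rank function pulls back (★ `BTGroup.Hom.hrank_baseChange`) and `Fix (ε_a ×_R R′) ≅ Fix ε_a′`
layerwise along `(𝒜[p^∞]) ×_R R′ ≅ (𝒜 ×_R R′)[p^∞]` (§1–§3). [cite: RapoportSmithlingZhang2020Diagonal, §4.1 (p. 17)] [cite: Messing1972, Ch. I (1.1)–(1.6)]
[cite: StacksProject, Tag 02KA] -/
theorem hrank_blockBTGroup_baseChange (ha2 : ∀ n, a n * a n - a n ∈ Ideal.span {(p : O) ^ n}) {h : ℕ}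
    (hrank : ∀ n (s : ↥(Spec (.of R))),
      (((act.isRingActionBT_pDivisibleGroupMap hp hg).homOfCompatibleFamily a ha).fixLayer n).hom.finrank s = p ^ (n * h))
    (n : ℕ) (s' : ↥(Spec (.of R'))) :
    ((((act.baseChange σ).isRingActionBT_pDivisibleGroupMap hp (hg.baseChange σ)).homOfCompatibleFamily a ha).fixLayer n).hom.finrank s' =
      p ^ (n * h) := by
  obtain ⟨e, he⟩ := 𝒜.exists_iso_baseChange_pDivisibleGroup hp hg σ
  have hε := (act.isRingActionBT_pDivisibleGroupMap hp hg).homOfCompatibleFamily_idem a ha ha2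
  have hε' := ((act.baseChange σ).isRingActionBT_pDivisibleGroupMap hp (hg.baseChange σ)).homOfCompatibleFamily_idem a ha ha2
  have hcomm := 𝒜.baseChange_homOfCompatibleFamily_app_comp hp hg σ act a ha e.hom he n
  rw [← BTGroup.Hom.hrank_baseChange σ _ hε h hrank n s']
  letI := ((𝒜.pDivisibleGroup hp hg).baseChange σ).grpObj n
  letI := ((𝒜.baseChange σ).pDivisibleGroup hp (hg.baseChange σ)).grpObj n
  haveI := (((act.baseChange σ).isRingActionBT_pDivisibleGroupMap hp (hg.baseChange σ)).homOfCompatibleFamily a ha).isFinite_fixLayer_hom n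
  haveI := (((act.baseChange σ).isRingActionBT_pDivisibleGroupMap hp (hg.baseChange σ)).homOfCompatibleFamily a ha).flat_fixLayer_hom hε' n
  exact (IdempotentSplitting.finrank_fix_hom_eq_of_iso _ _ (e.app n) hcomm.symm s').symm

/-- **… and conversely ∕ pointwise form**: the rank of the `n`-th layer of `Fix ε_a′` at `s′ ∈ Spec R′` IS the rank of the `n`-th layer of `Fix ε_a`
at `σ s′` (no hypothesis `hrank`). [cite: StacksProject, Tag 02KA] [cite: Messing1972, Ch. I (1.1)–(1.6)] -/
theorem finrank_fixLayer_blockBTGroup_baseChange (ha2 : ∀ n, a n * a n - a n ∈ Ideal.span {(p : O) ^ n}) (n : ℕ) (s' : ↥(Spec (.of R'))) :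
    ((((act.baseChange σ).isRingActionBT_pDivisibleGroupMap hp (hg.baseChange σ)).homOfCompatibleFamily a ha).fixLayer n).hom.finrank s' =
      (((act.isRingActionBT_pDivisibleGroupMap hp hg).homOfCompatibleFamily a ha).fixLayer n).hom.finrank (σ s') := by
  obtain ⟨e, he⟩ := 𝒜.exists_iso_baseChange_pDivisibleGroup hp hg σ
  have hε := (act.isRingActionBT_pDivisibleGroupMap hp hg).homOfCompatibleFamily_idem a ha ha2
  have hε' := ((act.baseChange σ).isRingActionBT_pDivisibleGroupMap hp (hg.baseChange σ)).homOfCompatibleFamily_idem a ha ha2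
  have hcomm := 𝒜.baseChange_homOfCompatibleFamily_app_comp hp hg σ act a ha e.hom he n
  rw [← BTGroup.Hom.finrank_fixLayer_baseChange σ _ hε n s']
  letI := ((𝒜.pDivisibleGroup hp hg).baseChange σ).grpObj n
  letI := ((𝒜.baseChange σ).pDivisibleGroup hp (hg.baseChange σ)).grpObj n
  haveI := (((act.baseChange σ).isRingActionBT_pDivisibleGroupMap hp (hg.baseChange σ)).homOfCompatibleFamily a ha).isFinite_fixLayer_hom n
  haveI := (((act.baseChange σ).isRingActionBT_pDivisibleGroupMap hp (hg.baseChange σ)).homOfCompatibleFamily a ha).flat_fixLayer_hom hε' n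
  exact (IdempotentSplitting.finrank_fix_hom_eq_of_iso _ _ (e.app n) hcomm.symm s').symm

/-! ## §5 Composite with ★ `RingAction.hrank_of_natCard_fixedPoints`: from the count at a geometric point of `Spec R` to `hrank` on every `Spec R′ → Spec R` -/

/-- **BLOCK HEIGHT ON EVERY FIBRE FROM ONE GEOMETRIC POINT COUNT, count in `𝒜 ×_R Ω`-currency (GEN's one-call form of socket (S-H)).**  `R` LOCAL,
`gΩ : Spec Ω → Spec R` a geometric point with `(p : Ω) ≠ 0` (e.g. a geometric generic point in characteristic `0`); if for every `n` the `Ω`-points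
`y` of `(𝒜 ×_R Ω)[pⁿ]` FIXED BY `((ι (a n)) ×_R Ω)[pⁿ]` — i.e. by the block idempotent `e_w` acting on `A_Ω[pⁿ](Ω)` — number `p^{n h}`, then for every
`σ : Spec R′ → Spec R` (in particular the special fibre `R′ := κ`) the layers of the `w`-block `Fix ε_a′ ⊆ (𝒜 ×_R R′)[p^∞]` have rank `p^{n h}` at
every point: `hrank` with height `h`, VERBATIM the hypothesis of ★ `BTGroup.Hom.fixBTGroup` ∕ ★ `PDivisibleGroupBlockDocking` for `A := 𝒜 ×_R R′`,
`act := act ×_R R′` (★ `RingAction.hrank_of_natCard_fixedPoints` on `Spec R` ▸ §4; ★ `hrank_specialFibre_of_natCard_fixedPoints` is the case `R′` a field).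
[cite: Tate1967, §2 (2.1)–(2.2)] [cite: RapoportSmithlingZhang2020Diagonal, §4.1 (p. 17)] [cite: Messing1972, Ch. I (1.1)–(1.6)] [cite: StacksProject, Tag 02KA] -/
theorem hrank_blockBTGroup_baseChange_of_natCard_fixedPoints [IsLocalRing R] (ha2 : ∀ n, a n * a n - a n ∈ Ideal.span {(p : O) ^ n})
    {Ω : Type u} [Field Ω] [IsAlgClosed Ω] (gΩ : Spec (.of Ω) ⟶ Spec (.of R)) (hpΩ : (p : Ω) ≠ 0) [IsCommMonObj (𝒜.baseChange gΩ).X]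
    {h : ℕ}
    (hcount : ∀ n, Nat.card {y : 𝟙_ (Over (Spec (.of Ω))) ⟶ (𝒜.baseChange gΩ).torsion (p ^ n) //
      y ≫ (haveI := (act.baseChange gΩ).isMonHom_i (a n); torsionMap ((act.baseChange gΩ).i (a n)) (p ^ n)) = y} = p ^ (n * h))
    (n : ℕ) (s' : ↥(Spec (.of R'))) :
    ((((act.baseChange σ).isRingActionBT_pDivisibleGroupMap hp (hg.baseChange σ)).homOfCompatibleFamily a ha).fixLayer n).hom.finrank s' =
      p ^ (n * h) :=
  𝒜.hrank_blockBTGroup_baseChange hp hg act a ha σ ha2 (RingAction.hrank_of_natCard_fixedPoints hp hg act a ha ha2 gΩ hpΩ hcount) n s'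

end Head

end AbelianSchemeOver

end Literature.AlgebraicGeometry.AbelianSchemes

end
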